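import Literature.Topology.FourManifolds.CircleMapWinding
import Literature.AlgebraicTopology.FundamentalGroup.PuncturedPlane
import HarnessLib

/-!
# Circle-valued maps on `S × (ℂ ∖ 0)` with vanishing slice winding lift to `ℝ`

Topic `Literature/Topology/FourManifolds`; a companion of `CircleMapWinding.lean`
(`exists_lift_of_degree_eq_zero`: a torus map with both degrees zero lifts through
`exp : ℝ → S¹`), for the product `S × (ℂ ∖ 0)` with `S` simply connected, through the cover
`S × ℂ → S × (ℂ ∖ 0)`, `(s, ζ) ↦ (s, e^ζ)` (Hatcher, *Algebraic Topology* (2002), Prop. 1.33, the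
lifting criterion, made explicit: the lift to the simply connected cover has period `2π ·` the
winding number along the slice winding loop `t ↦ (s₀, e^{2πit})`, `PuncturedPlane.sliceWindingLoop`).

* `CircleMaps.exists_lift_of_winding_sliceWindingLoop_eq_zero` — if `G : S × (ℂ ∖ 0) → S¹` winds
  `0` times along the slice winding loop, then `G = exp ∘ Λ` for a continuous `Λ : S × (ℂ ∖ 0) → ℝ`.

Used by the flat-disc exterior of a topologically slice knot (`FlatDiscMeridianLongitude.lean`:
the punctured product neighbourhood of the flat plane is `ℝ² × (ℂ ∖ 0)`), to normalise a
circle-valued map near the plane. Everything is proved; no definitions, no named facts.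

## References

* A. Hatcher, *Algebraic Topology*, CUP 2002, §1.3 Prop. 1.33 (lifting criterion), §1.1 Thm. 1.7.
  [HatcherAT2002]
-/

noncomputable section

open Set Function Complex Topology
open scoped Real unitInterval
open Literature.AlgebraicTopology.FundamentalGroup.PuncturedPlane

namespace Literature.Topology.FourManifolds

namespace CircleMaps

variable {S : Type*} [TopologicalSpace S]

/-- The cover `S × ℂ → S × (ℂ ∖ 0)`, `(s, ζ) ↦ (s, e^ζ)`, is a quotient map (continuous, open and
onto). [folklore] -/
theorem isQuotientMap_prodMap_expCover :
    IsQuotientMap (Prod.map (id : S → S) expCover) := by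
  have hopen : IsOpenMap expCover := isCoveringMap_expCover.isLocalHomeomorph.isOpenMap
  have hsurj : Surjective expCover := fun z =>
    ⟨Complex.log z, Subtype.ext (Complex.exp_log z.2)⟩
  exact (IsOpenMap.id.prodMap hopen).isQuotientMap (continuous_id.prodMap continuous_expCover)
    (surjective_id.prodMap hsurj)

/-- `e^{ζ + 2πi} = e^ζ` in `ℂ ∖ 0`. [folklore] -/
theorem expCover_add_two_pi_I (ζ : ℂ) : expCover (ζ + 2 * π * Complex.I) = expCover ζ :=
  Subtype.ext (by simp [expCover, Complex.exp_add])

/-- **A circle-valued map on `S × (ℂ ∖ 0)`, `S` simply connected, which winds `0` times along the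
slice winding loop lifts to a continuous real function** (Hatcher 2002, Prop. 1.33, through the
cover `S × ℂ → S × (ℂ ∖ 0)`). [cite: HatcherAT2002, Prop. 1.33] -/
theorem exists_lift_of_winding_sliceWindingLoop_eq_zero [SimplyConnectedSpace S]
    [LocallyPathConnectedSpace S] (G : C(S × CStar, Circle)) (s₀ : S)
    (h : winding G (sliceWindingLoop s₀ 1 one_pos) = 0) :
    ∃ Λ : C(S × CStar, ℝ), ∀ p, Circle.exp (Λ p) = G p := by
  -- the cover and the lift of `G ∘ cover`
  set cov : C(S × ℂ, S × CStar) := ⟨Prod.map id expCover, continuous_id.prodMap continuous_expCover⟩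
    with hcov
  have hcov_apply : ∀ m : S × ℂ, cov m = (m.1, expCover m.2) := fun m => rfl
  haveI : SimplyConnectedSpace (S × ℂ) := simplyConnectedSpace_prod
  haveI : LocallyPathConnectedSpace (S × ℂ) :=
    .of_bases (fun p ↦ (LocallyPathConnectedSpace.path_connected_basis p.1).prod_nhds
        (LocallyPathConnectedSpace.path_connected_basis p.2))
      fun _ _ hi ↦ hi.1.2.prod hi.2.2
  obtain ⟨L, ⟨-, hL⟩, -⟩ := Circle.isCoveringMap_exp.existsUnique_continuousMap_lifts
    (G.comp cov) (s₀, 0) ((G (s₀, expCover 0) : ℂ).arg) (by simp [Circle.exp_arg, hcov_apply])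
  have hLm : ∀ m : S × ℂ, Circle.exp (L m) = G (cov m) := fun m => congr_fun hL m
  -- the period along `ζ ↦ ζ + 2πi` is an integer multiple of `2π`, constant in `m`
  set v : ℂ := 2 * π * Complex.I with hv
  have hshift : ∀ m : S × ℂ, cov (m.1, m.2 + v) = cov m := fun m => by
    rw [hcov_apply, hcov_apply, hv, expCover_add_two_pi_I]
  have hint : ∀ m : S × ℂ, ∃ k : ℤ, (L (m.1, m.2 + v) - L m) / (2 * π) = k := fun m => by
    obtain ⟨k, hk⟩ := Circle.exp_eq_exp.1 (show Circle.exp (L (m.1, m.2 + v)) = Circle.exp (L m) by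
      rw [hLm, hLm, hshift])
    exact ⟨k, by rw [hk]; field_simp; ring⟩
  have hc : Continuous fun m : S × ℂ => (L (m.1, m.2 + v) - L m) / (2 * π) := by fun_prop
  have hconst : ∀ m : S × ℂ, L (m.1, m.2 + v) - L m = L (s₀, 0 + v) - L (s₀, 0) := fun m => by
    have e := apply_eq_of_isPreconnected_of_forall_int isPreconnected_univ hc.continuousOn
      (fun m _ => hint m) (mem_univ m) (mem_univ (s₀, (0 : ℂ)))
    have hπ : (2 * π : ℝ) ≠ 0 := by positivity
    field_simp at e
    linarith
  -- the period at `(s₀, 0)` is `2π ·` the winding number along the slice winding loop, i.e. `0`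
  have hp : L (s₀, 0 + v) - L (s₀, 0) = 0 := by
    have e := incr_eq_of_lift G (sliceWindingLoop s₀ 1 one_pos)
      (G := fun t : I => L (s₀, (2 * π * t : ℝ) * Complex.I)) (by fun_prop) (fun t => by
        rw [hLm]
        congr 1
        rw [hcov_apply, sliceWindingLoop_apply]
        refine Prod.ext rfl (Subtype.ext ?_)
        simp [expCover, windingLoop_apply_coe])
    rw [incr_eq_winding, h] at e
    simp only [Int.cast_zero, zero_mul, Set.Icc.coe_one, mul_one, Set.Icc.coe_zero, mul_zero,
      Complex.ofReal_zero, zero_mul] at e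
    rw [zero_add, hv]
    have : ((2 * π : ℝ) : ℂ) * Complex.I = 2 * π * Complex.I := by push_cast; ring
    rw [← this]
    linarith
  have hper : ∀ m : S × ℂ, L (m.1, m.2 + v) = L m := fun m => by
    have := hconst m; rw [hp] at this; linarith
  have hperZ : ∀ (k : ℤ) (m : S × ℂ), L (m.1, m.2 + k * v) = L m := fun k m => by
    have hP : Function.Periodic (fun ζ => L (m.1, ζ)) v := fun ζ => hper (m.1, ζ)
    have e := hP.int_mul k m.2
    simpa using e
  -- descend along the quotient map
  set Λ : S × CStar → ℝ := fun p => L (p.1, Complex.log p.2) with hΛ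
  have hΛc : ∀ m : S × ℂ, Λ (cov m) = L m := by
    rintro ⟨s, ζ⟩
    simp only [hΛ, hcov_apply]
    obtain ⟨k, hk⟩ := Complex.exp_eq_exp_iff_exists_int.1
      (show Complex.exp (Complex.log (expCover ζ)) = Complex.exp ζ from Complex.exp_log (expCover ζ).2)
    have : Complex.log (expCover ζ : ℂ) = ζ + k * v := by rw [hk, hv]
    change L (s, Complex.log (expCover ζ : ℂ)) = L (s, ζ)
    rw [this]
    exact hperZ k (s, ζ)
  have hcont : Continuous Λ := by
    rw [isQuotientMap_prodMap_expCover.continuous_iff]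
    have e : Λ ∘ Prod.map id expCover = L := funext hΛc
    rw [e]
    exact L.continuous
  refine ⟨⟨Λ, hcont⟩, fun p => ?_⟩
  obtain ⟨m, rfl⟩ := isQuotientMap_prodMap_expCover.surjective p
  change Circle.exp (Λ (cov m)) = G (cov m)
  rw [hΛc, hLm]

end CircleMaps

end Literature.Topology.FourManifolds

end
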